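import Summits.CriticalPhenomena.CardyFormulaZ2.Theorems.CardyComplexConeEdgePrecompactUFRSArmDominationStrands
import Summits.CriticalPhenomena.CardyFormulaZ2.Theorems.CardyComplexConeEdgePrecompactUFRSArmDominationExit

/-!
# Arm domination at an exit corner of the translate: the FACE case and the run ending on the stretch
(line `qkz-strip-boundary-arm` of crux `CardyComplexCone.EdgePrecompact`, stmt-CriticalPhenomena-11387;
deterministic assembly of the corrected item (H₁) `ufrs_armDomination2` of the road map for the
uniform forward response stability "UFRS"; FACE branch of `ufrs_failureStructure` and case (4)(b)
of `ufrs_lastDeparture`)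

Two branches of the UFRS failure analysis end with a corner `O₀ a i` OF THE FIRST STRETCH which
is THE exit corner of the translate `E₁ = shiftData E w` (vertex on `A₁`, target edge the marked
edge `e_b + w`): the FACE discrepancy (`ufrs_faceExit`, `i = m`), and the SPLIT discrepancy whose
second run ends on the stretch by leaving the inner faces of `E₁` (`ufrs_lastDeparture` (4)(b),
`i` = the last contact). `ufrs_exitCornerOnStretch_cert` certifies both in the NEAR branch of
the certificate `ufrsCert E w z (4η) (ρ/2)` of `…UFRSEvents.lean` at the collar point
`z = E.δ (O₀ a i).1`: the marked edge is within `E.δ` of `z`, and two corner-disjoint long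
strands of the completed dynamics of `E` leave `z` — the continuation `O₀ a [i, n]` of the first
stretch (to the ball), and
* for the START pair, the RETURN JOURNEY `O₀ a [n + 1, N]` of the exploration of `E` from the
  ball to its exit corner, which is the translate `((O₀ a i).1 - w, (O₀ a i).2)`
  (`exists_returnJourney_W3H`), at distance `‖E.δ w‖ < η` from `z`;
* for an exit corner `a` of the ball, the incoming whisker `O₀ a [0, i)` back to `a`.
`ufrs_faceCase_cert` (registered) is the FACE instance.

References: S. Smirnov, C. R. Acad. Sci. Paris 333 (2001), §2; P. Nolin, Electron. J. Probab. 13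
(2008), §4.
-/

namespace Summit.CriticalPhenomena.CardyFormulaZ2.Cruxes.EdgePrecompact.QkzStripBoundaryArm

open MeasureTheory Filter Set Metric
open scoped Topology BigOperators Pointwise
open Literature.Probability.LatticeModels Literature.Probability.Percolation
open Literature.Probability.RandomPlanarGeometry (DobrushinDomain)
open Summit.CriticalPhenomena.CardyFormulaZ2.Theses.CardyComplexCone

noncomputable section

/-- **An exit-type corner of the translate on the first stretch certifies (NEAR).** For
`η > 0` there is `δ₀ > 0` such that for every admissible datum `E` of `D` with `E.δ < δ₀`,
shift `‖E.δ w‖ < η`, ball `B(E.δ v, ρ)` with `4η ≤ ρ` and `2ρ`-deep centre, configuration `ω`,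
admissible pair `(a, a')`, good first stretch `O₀ a [0, n]` re-entering the ball at `n`, and
index `i ≤ n` whose corner `O₀ a i` is exit-type for the translate `shiftData E w` (vertex on
`A₁`, target edge ending on `B₁` and targeted at the vertex — the marked edge `e_b + w`) with its
vertex `z` in the `3η`-collar: `ω ∈ ufrsCert E w z (4η) (ρ/2)` with `z ∈ D`. Proof: the marked
edge is within `E.δ` of `z`; the continuation `O₀ a [i, n]` is a long strand; the second long
strand is the return journey `O₀ a [n + 1, N]` of the exploration of `E` to its exit corner
`((O₀ a i).1 - w, (O₀ a i).2)` (start pair, `exists_returnJourney_W3H`), or the whisker `O₀ a [0, i)`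
back to the deep corner `a` (exit corner of the ball); escape clause if `ρ/2 < 256 · 4η`. -/
theorem ufrs_exitCornerOnStretch_cert : ∀ (D : DobrushinDomain) (η : ℝ), 0 < η → ∃ δ₀ > (0:ℝ), ∀ E : DiscreteDobrushin, E.Ω = D.carrier → E.IsZdAdmissible → E.δ < δ₀ → ∀ (v w : Site 2) (ρ : ℝ), 4 * η ≤ ρ → 2 * ρ ≤ infDist (meshPoint E.δ v) D.carrierᶜ → ‖meshPoint E.δ w‖ < η → ∀ (ω : BondConfig (Site 2)) (a a' : Site 2 × Fin 4) (n i : ℕ), ((E.IsStartCorner a ∧ (shiftData E w).IsStartCorner a') ∨ (a = a' ∧ medialPoint E.δ (cSrc a) ∈ ball (meshPoint E.δ v) ρ ∧ medialPoint E.δ (cTgt a) ∉ ball (meshPoint E.δ v) ρ)) → (∀ i < n, medialPoint E.δ (cTgt (cornerOrbit (E.bcBondConfig ω) a i)) ∉ ball (meshPoint E.δ v) ρ ∧ E.IsInnerFace (cFace (cornerOrbit (E.bcBondConfig ω) a (i + 1)))) → medialPoint E.δ (cTgt (cornerOrbit (E.bcBondConfig ω) a n)) ∈ ball (meshPoint E.δ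 v) ρ → i ≤ n → (cornerOrbit (E.bcBondConfig ω) a i).1 ∈ (shiftData E w).zdArcA → (cornerOrbit (E.bcBondConfig ω) a i).1 + cornerUnit ((cornerOrbit (E.bcBondConfig ω) a i).2 + 1) ∈ (shiftData E w).zdArcB → (shiftData E w).IsInEdge (cornerOrbit (E.bcBondConfig ω) a i).1 ((cornerOrbit (E.bcBondConfig ω) a i).2 + 1) → infDist (meshPoint E.δ (cornerOrbit (E.bcBondConfig ω) a i).1) D.carrierᶜ < 3 * η → ∃ z ∈ D.carrier, infDist z D.carrierᶜ < 3 * η ∧ ω ∈ ufrsCert E w z (4 * η) (ρ / 2) := by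
  intro D η hη
  obtain ⟨δ₂, hδ₂, hcollar⟩ := collarAgreement D η hη
  refine ⟨min δ₂ η, lt_min hδ₂ hη, ?_⟩
  intro E hEΩ hE hEδ v w ρ hηρ hv hw ω a a' n i hpair hStr hball hin hA hB hIn hcol
  have hδ : 0 < E.δ := hE.delta_pos
  have hδ₂' : E.δ < δ₂ := lt_of_lt_of_le hEδ (min_le_left _ _)
  have hδη : E.δ ≤ η := (lt_of_lt_of_le hEδ (min_le_right _ _)).le
  have hAB : cTgt (cornerOrbit (E.bcBondConfig ω) a i) ∈ (shiftData E w).zdABEdges := DiscreteDobrushin.cSrc_mem_zdABEdges hA hB (Or.inr hIn)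
  -- faces at deep vertices are inner for both data; faces along the first stretch are inner
  have hinner : ∀ x : Site 2, 3 * η ≤ infDist (meshPoint E.δ x) D.carrierᶜ → ∀ f : Site 2,
      IsCorner x f → E.IsInnerFace f ∧ (shiftData E w).IsInnerFace f := fun x hx =>
    (hcollar E hEΩ hE hδ₂' w hw ω x hx x (by rw [dist_self]; positivity)).2
  have hfaceE : ∀ t ≤ n, E.IsInnerFace (cFace (cornerOrbit (E.bcBondConfig ω) a t)) := by
    intro t ht
    rcases Nat.eq_zero_or_pos t with rfl | hpos
    · rcases hpair with ⟨ha, -⟩ | ⟨-, haI, -⟩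
      · exact ha.isOutEdge.1
      · exact (hinner a.1 (deep_of_cSrc_mem_ball hδ.le hδη hηρ hv haI) _ (isCorner_cFace a)).1
    · obtain ⟨t', rfl⟩ : ∃ t', t = t' + 1 := ⟨t - 1, by omega⟩
      exact (hStr t' (by omega)).2
  have hsimple : ∀ i₁ i₂ : ℕ, i₁ ≤ n → i₂ ≤ n →
      cornerOrbit (E.bcBondConfig ω) a i₁ = cornerOrbit (E.bcBondConfig ω) a i₂ → i₁ = i₂ :=
    fun i₁ i₂ h1 h2 h => cornerOrbit_injOn_stretch
      (I := {x | medialPoint E.δ x ∈ ball (meshPoint E.δ v) ρ}) (fun i hi => (hStr i hi).1) hball h1 h2 h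
  have hzD : (meshPoint E.δ (cornerOrbit (E.bcBondConfig ω) a i).1) ∈ D.carrier := by
    rw [← hEΩ]
    exact (ufrs_discrepancyEdges E w ω).2.2 _ (hfaceE i hin)
  refine ⟨(meshPoint E.δ (cornerOrbit (E.bcBondConfig ω) a i).1), hzD, hcol, ?_⟩
  by_cases hesc : ρ / 2 < 256 * (4 * η)
  · exact mem_ufrsCert_of_lt_W3H hesc
  rw [not_lt] at hesc
  -- the continuation of the first stretch is a long strand at `z`
  have hfar_n : ρ - 3 * η - 2 * E.δ - 0 < dist (meshPoint E.δ (cornerOrbit (E.bcBondConfig ω) a n).1) (meshPoint E.δ (cornerOrbit (E.bcBondConfig ω) a i).1) :=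
    far_of_near_cTgt_mem_ball_W3H hδ.le hv hcol (by rw [dist_self]) hball (by rw [dist_self]; exact hδ.le)
  have hσ₁ : i ≤ n ∧ ((dist (meshPoint E.δ (cornerOrbit (E.bcBondConfig ω) a i).1) (meshPoint E.δ (cornerOrbit (E.bcBondConfig ω) a i).1) ≤ (128 * (4 * η)) ∧ (ρ / 2 / 2) ≤ dist (meshPoint E.δ (cornerOrbit (E.bcBondConfig ω) a n).1) (meshPoint E.δ (cornerOrbit (E.bcBondConfig ω) a i).1)) ∨ ((ρ / 2 / 2) ≤ dist (meshPoint E.δ (cornerOrbit (E.bcBondConfig ω) a i).1) (meshPoint E.δ (cornerOrbit (E.bcBondConfig ω) a i).1) ∧ dist (meshPoint E.δ (cornerOrbit (E.bcBondConfig ω) a n).1) (meshPoint E.δ (cornerOrbit (E.bcBondConfig ω) a i).1) ≤ (128 * (4 * η)))) ∧ (∀ t, i ≤ t → t ≤ n → E.IsInnerFace (cFace (cornerOrbit (E.bcBondConfig ω) a t))) ∧ (∀ s t, i ≤ s → s < t → t ≤ n → cornerOrbit (E.bcBondConfig ω) a s ≠ cornerOrbit (E.bcBondConfig ω) a t) :=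 by
    refine ⟨hin, Or.inl ⟨?_, ?_⟩, fun t _ ht => hfaceE t ht, stretch_ne_of_lt_W3H hsimple le_rfl⟩
    · rw [dist_self]; positivity
    · linarith
  apply mem_ufrsCert_of_near_W3H
  apply mem_ufrsCertNear_of_strands_W3H
  · -- the marked edge `cTgt (O₀ a i)` of the translate is within `E.δ` of `z`
    rw [mem_ufrsMarkedNbhd_iff]
    refine ⟨cTgt (cornerOrbit (E.bcBondConfig ω) a i), Or.inr hAB, ?_⟩
    have := dist_medialPoint_cTgt_le' hδ.le (cornerOrbit (E.bcBondConfig ω) a i)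
    linarith
  rcases hpair with ⟨ha, -⟩ | ⟨rfl, haI, -⟩
  · -- START pair: the second strand is the return journey of the exploration of `E`
    obtain ⟨N, hnN, hNin, hNne, hq⟩ := exists_returnJourney_W3H hE ω ha (fun t ht => (hStr t ht).2)
      (fun f hf => (hinner _ (deep_of_cTgt_mem_ball_W3H hδ.le hδη hηρ hv hball) f hf).1) hA hB hIn
    have hfar₂ : ρ / 2 / 2 ≤ dist (meshPoint E.δ (cornerOrbit (E.bcBondConfig ω) a (n + 1)).1) (meshPoint E.δ (cornerOrbit (E.bcBondConfig ω) a i).1) := by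
      have h1 := dist_meshPoint_cornerOrbit_succ_le (E.bcBondConfig ω) a E.δ n
      rw [abs_of_pos hδ] at h1
      have := far_of_near_cTgt_mem_ball_W3H hδ.le hv hcol (z := (meshPoint E.δ (cornerOrbit (E.bcBondConfig ω) a i).1)) (s := 0) (by rw [dist_self]) hball h1
      linarith
    have hnear₂ : dist (meshPoint E.δ (cornerOrbit (E.bcBondConfig ω) a N).1) (meshPoint E.δ (cornerOrbit (E.bcBondConfig ω) a i).1) ≤ 128 * (4 * η) := by
      rw [hq, dist_meshPoint_sub_shift_W3H]
      linarith [hw.le]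
    have hσ₂ : (n + 1) ≤ N ∧ ((dist (meshPoint E.δ (cornerOrbit (E.bcBondConfig ω) a (n + 1)).1) (meshPoint E.δ (cornerOrbit (E.bcBondConfig ω) a i).1) ≤ (128 * (4 * η)) ∧ (ρ / 2 / 2) ≤ dist (meshPoint E.δ (cornerOrbit (E.bcBondConfig ω) a N).1) (meshPoint E.δ (cornerOrbit (E.bcBondConfig ω) a i).1)) ∨ ((ρ / 2 / 2) ≤ dist (meshPoint E.δ (cornerOrbit (E.bcBondConfig ω) a (n + 1)).1) (meshPoint E.δ (cornerOrbit (E.bcBondConfig ω) a i).1) ∧ dist (meshPoint E.δ (cornerOrbit (E.bcBondConfig ω) a N).1) (meshPoint E.δ (cornerOrbit (E.bcBondConfig ω) a i).1) ≤ (128 * (4 * η)))) ∧ (∀ t, (n + 1) ≤ t → t ≤ N → E.IsInnerFace (cFace (cornerOrbit (E.bcBondConfig ω) a t))) ∧ (∀ s t, (n + 1) ≤ s → s < t → t ≤ N → cornerOrbit (E.bcBondConfig ω) a s ≠ cornerOrbit (E.bcBondConfig ω) a t) :=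
      ⟨hnN, Or.inr ⟨hfar₂, hnear₂⟩, fun t _ ht => hNin t ht, fun s t _ hst htN => hNne s t hst htN⟩
    have hdisj : ∀ s t, i ≤ s → s ≤ n → (n + 1) ≤ t → t ≤ N → cornerOrbit (E.bcBondConfig ω) a s ≠ cornerOrbit (E.bcBondConfig ω) a t :=
      fun s t _ hsn ht htN => hNne s t (by omega) htN
    exact mem_ufrsStrands_two_W3H true true a a i n (n + 1) N hσ₁ hσ₂ hdisj
  · -- an exit corner of the ball: the second strand is the incoming whisker, back to `a`
    have hi1 : 1 ≤ i := by
      rcases Nat.eq_zero_or_pos i with h0 | h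
      · exfalso
        have hdeep := deep_of_cSrc_mem_ball (Ω := D.carrier) hδ.le hδη hηρ hv haI
        have : cornerOrbit (E.bcBondConfig ω) a i = a := by rw [h0]; rfl
        rw [this] at hcol
        linarith
      · exact h
    have hfar₂ : ρ / 2 / 2 ≤ dist (meshPoint E.δ (cornerOrbit (E.bcBondConfig ω) a 0).1) (meshPoint E.δ (cornerOrbit (E.bcBondConfig ω) a i).1) := by
      have := far_of_cSrc_mem_ball (E := E) hδ.le hv hcol haI
      show ρ / 2 / 2 ≤ dist (meshPoint E.δ a.1) _
      linarith
    have hnear₂ : dist (meshPoint E.δ (cornerOrbit (E.bcBondConfig ω) a (i - 1)).1) (meshPoint E.δ (cornerOrbit (E.bcBondConfig ω) a i).1) ≤ 128 * (4 * η) := by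
      have h1 := dist_meshPoint_cornerOrbit_succ_le (E.bcBondConfig ω) a E.δ (i - 1)
      rw [abs_of_pos hδ, Nat.sub_add_cancel hi1, dist_comm] at h1
      linarith
    have hσ₂ : 0 ≤ (i - 1) ∧ ((dist (meshPoint E.δ (cornerOrbit (E.bcBondConfig ω) a 0).1) (meshPoint E.δ (cornerOrbit (E.bcBondConfig ω) a i).1) ≤ (128 * (4 * η)) ∧ (ρ / 2 / 2) ≤ dist (meshPoint E.δ (cornerOrbit (E.bcBondConfig ω) a (i - 1)).1) (meshPoint E.δ (cornerOrbit (E.bcBondConfig ω) a i).1)) ∨ ((ρ / 2 / 2) ≤ dist (meshPoint E.δ (cornerOrbit (E.bcBondConfig ω) a 0).1) (meshPoint E.δ (cornerOrbit (E.bcBondConfig ω) a i).1) ∧ dist (meshPoint E.δ (cornerOrbit (E.bcBondConfig ω) a (i - 1)).1) (meshPoint E.δ (cornerOrbit (E.bcBondConfig ω) a i).1) ≤ (128 * (4 * η)))) ∧ (∀ t, 0 ≤ t → t ≤ (i - 1) → E.IsInnerFace (cFace (cornerOrbit (E.bcBondConfig ω) a t))) ∧ (∀ s t, 0 ≤ s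 → s < t → t ≤ (i - 1) → cornerOrbit (E.bcBondConfig ω) a s ≠ cornerOrbit (E.bcBondConfig ω) a t) :=
      ⟨Nat.zero_le _, Or.inr ⟨hfar₂, hnear₂⟩, fun t _ ht => hfaceE t (by omega), stretch_ne_of_lt_W3H hsimple (by omega)⟩
    have hdisj : ∀ s t, i ≤ s → s ≤ n → 0 ≤ t → t ≤ (i - 1) → cornerOrbit (E.bcBondConfig ω) a s ≠ cornerOrbit (E.bcBondConfig ω) a t := by
      intro s t hs hsn _ hti h
      have := hsimple s t hsn (by omega) h
      omega
    exact mem_ufrsStrands_two_W3H true true a a i n 0 (i - 1) hσ₁ hσ₂ hdisj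

/-- **FACE discrepancies are certified** (registered sub-goal `ufrs_faceCase_cert` of
stmt-CriticalPhenomena-11387; the FACE branch of the corrected arm domination `ufrs_armDomination2`).
Hypotheses: verbatim those of `ufrs_faceExit` (fine admissible datum of `D`, shift
`‖E.δ w‖ < η`, ball `B(E.δ v, ρ)` with `4η ≤ ρ` and `2ρ`-deep centre, admissible pair, good
first stretch re-entering the ball at `n`, synchronised index `m < n` followed by a FACE
discrepancy). By `ufrs_faceExit` the corner `O₀ a m` is the exit corner of the translate, in
the collar, so `ufrs_exitCornerOnStretch_cert` applies. -/
theorem ufrs_faceCase_cert : ∀ (D : DobrushinDomain) (η : ℝ), 0 < η → ∃ δ₀ > (0:ℝ), ∀ E : DiscreteDobrushin, E.Ω = D.carrier → E.IsZdAdmissible → E.δ < δ₀ → ∀ (v w : Site 2) (ρ : ℝ), 4 * η ≤ ρ → 2 * ρ ≤ infDist (meshPoint E.δ v) D.carrierᶜ → ‖meshPoint E.δ w‖ < η → ∀ (ω : BondConfig (Site 2)) (a a' : Site 2 × Fin 4) (n m k : ℕ), ((E.IsStartCorner a ∧ (shiftData E w).IsStartCorner a') ∨ (a = a' ∧ medialPoint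 E.δ (cSrc a) ∈ ball (meshPoint E.δ v) ρ ∧ medialPoint E.δ (cTgt a) ∉ ball (meshPoint E.δ v) ρ)) → (∀ i < n, medialPoint E.δ (cTgt (cornerOrbit (E.bcBondConfig ω) a i)) ∉ ball (meshPoint E.δ v) ρ ∧ E.IsInnerFace (cFace (cornerOrbit (E.bcBondConfig ω) a (i + 1)))) → medialPoint E.δ (cTgt (cornerOrbit (E.bcBondConfig ω) a n)) ∈ ball (meshPoint E.δ v) ρ → m < n → (∀ i < k, (shiftData E w).IsInnerFace (cFace (cornerOrbit ((shiftData E w).bcBondConfig ω) a' (i + 1)))) → cornerOrbit ((shiftData E w).bcBondConfig ω) a' k = cornerOrbit (E.bcBondConfig ω) a m → (cTgt (cornerOrbit (E.bcBondConfig ω) a m) ∈ E.bcBondConfig ω ↔ cTgt (cornerOrbit (E.bcBondConfig ω) a m) ∈ (shiftData E w).bcBondConfig ω) → cornerOrbit ((shiftData E w).bcBondConfig ω) a' (k + 1) = cornerOrbit (E.bcBondConfig ω) a (m + 1) → ¬ (shiftData E w).IsInnerFace (cFace (cornerOrbit (E.bcBondConfig ω) a (m + 1))) → ∃ z ∈ D.carrier,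 infDist z D.carrierᶜ < 3 * η ∧ ω ∈ ufrsCert E w z (4 * η) (ρ / 2) := by
  intro D η hη
  obtain ⟨δ₁, hδ₁, hface⟩ := ufrs_faceExit D η hη
  obtain ⟨δ₂, hδ₂, hcert⟩ := ufrs_exitCornerOnStretch_cert D η hη
  refine ⟨min δ₁ δ₂, lt_min hδ₁ hδ₂, ?_⟩
  intro E hEΩ hE hEδ v w ρ hηρ hv hw ω a a' n m k hpair hStr hball hmn hStr₁ hek hiff hstep hnot
  have hδ₁' : E.δ < δ₁ := lt_of_lt_of_le hEδ (min_le_left _ _)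
  have hδ₂' : E.δ < δ₂ := lt_of_lt_of_le hEδ (min_le_right _ _)
  obtain ⟨⟨hA, hB, hIn, -⟩, -, hcol, -⟩ :=
    hface E hEΩ hE hδ₁' v w ρ hηρ hv hw ω a a' n m k hpair hStr hball hmn hStr₁ hek hiff hstep hnot
  exact hcert E hEΩ hE hδ₂' v w ρ hηρ hv hw ω a a' n m hpair hStr hball hmn.le hA hB hIn hcol

end

end Summit.CriticalPhenomena.CardyFormulaZ2.Cruxes.EdgePrecompact.QkzStripBoundaryArm
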